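import Literature.MathematicalPhysics.QuantumFieldTheory.CentralTwistPolymers
import Literature.MathematicalPhysics.QuantumLattice.TwistedBoundaryConditions
import HarnessLib

/-!
# Polymer activities of a plaquette-dependent family of weights on a compact group, and the insertion of a
# general 't Hooft twist (all planes at once)

Topic `Literature/MathematicalPhysics/QuantumFieldTheory`; vocabulary of `ConstructiveQFTWave0.lean` (`GaugeConfig d L G`,
`Plaquette`, `Edge`, `plaquetteHolonomy`, `haarProbability G`), `CharacterActionPolymers.lean` (namespace `Tomboulis2007`:
`linkRel`, `torusPolymers`, `sheetAt`), `CentralTwistPolymers.lean` (namespace `CentralTwist`: `twistActivity z w V`,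
`twistPolymerActivity`, `twistZ d L z w V` — ONE twist element `z` on ONE plaquette set `V`) and `QuantumLattice/TwistedBoundaryConditions.lean` (`Twist d G = Plane d → Z(G)`,
`plaquetteTwist z p` — a centre element on the corner plaquette of EVERY plane). DEFINITIONS with elementary API; no fact,
nothing asserted about convergence.

E. T. Tomboulis, arXiv:0707.2179 [Tomboulis2007Confinement] §6.2 (6.5)–(6.10) expands `Z_Λ` and the twisted `Z⁻_Λ` in polymers
whose activities are Haar integrals of products of plaquette activities `g_p(U) = f(U_p) - 1` (6.7), the twist entering "through the
replacement (4.4)" on the plaquettes of the coclosed set `𝒱`; K. R. Ito, E. Seiler, arXiv:0803.3019 [ItoSeiler2008Further] Thm 2.2 (1)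
state the resulting area law of the vortex free energy for `G = U(1)`, `SU(2)` and "the analogous statement for `SU(N)` … with
`Z⁻` replaced by `Z^ω`".  G. 't Hooft, Nucl. Phys. B153 (1979) 141 [tHooft1979Flux] §2 (2.2)–(2.6) twists ALL planes at once
(twist tensor `n_{μν}`, partition functions `W{n; a_μ}`); the files `CentralTwist*.lean` treat one plane.  Nothing in the
expansion depends on the plaquette weight being the same function on every plaquette (K. Osterwalder, E. Seiler, Ann. Phys.
110 (1978) 440 §3 [OsterwalderSeilerAnnPhys1978]: only the smallness of the activities is used), and a general twist — indeed
any plaquette insertion `t : Plaquette → G`, the `insertedWilsonAction ρ t` of `TwistedPartitionFunction.lean` — is absorbed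
into a PLAQUETTE-DEPENDENT family of weights `w_p = w ∘ (t_p · )`.  This file sets the expansion up for such families:

* `twistBy t w` — the family `p ↦ w_p(t_p · )` (insertion `t` absorbed into the weights); `sheetFamily z w V` — the family of
  ONE weight `w` with `z` inserted on `V` (the datum of `CentralTwistPolymers.lean`); `twistInsertion z` — the insertion
  `p ↦ z_p⁻¹` of a 't Hooft twist `z : Twist d G` (`QuantumLattice.twistedHolonomy z U p = z_p⁻¹ U_p`);
* `fieldActivity w U p = w_p(U_p) - 1`, `fieldPolymerActivity w X = ∫ ∏_{p∈X} (w_p(U_p) - 1) ∏_b dU_b` (complex, `0` off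
  polymers; T07 (6.6)), `fieldZ d L w = ∫ ∏_p w_p(U_p) ∏_b dU_b` (T07 (4.5)/(6.5) for a family);
* `wilsonFamily ρ β` — Wilson's weight `e^{β Re tr ρ(·)}` as a constant family;
* `fieldActivity_sheetFamily`, `fieldPolymerActivity_sheetFamily`, `fieldZ_sheetFamily` — for a sheet family these ARE the
  objects of `CentralTwistPolymers.lean` (definitional).

HONEST FRAMING: finite-volume definitions and algebraic identities only; the convergent expansion, the twist locality and
the bound `1 - Z_z/Z_1 ≤ 2d² L^{d-2} e^{-L²/2}` for every twist `z` are the theorem files `PlaquetteFieldPolymerExpansion.lean`,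
`PlaquetteFieldTwistLocality.lean`, `PlaquetteFieldTwistBound.lean`.
-/

noncomputable section

open MeasureTheory Finset
open scoped BigOperators
open Literature.MathematicalPhysics.QuantumLattice
open Literature.Probability.LatticeModels (IsRConnected)

namespace Literature.MathematicalPhysics.QuantumFieldTheory

namespace CentralTwist

open Tomboulis2007

variable {d L : ℕ} {G : Type*} [Group G]

/-! ### Families of plaquette weights and insertions -/

/-- **Absorbing a plaquette insertion into the weights**: the family `p ↦ w_p(t_p · )` (for Wilson's weight
`w_p = e^{β Re tr ρ(·)}` and an insertion `t` this is the Gibbs factor of `insertedWilsonAction ρ t`; arXiv:0707.2179 (4.4):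
"the replacement `U_p → (-𝟙) U_p`" on the twisted plaquettes). [cite: Tomboulis2007Confinement, §4 eq. (4.4)]
[cite: Greensite2011Confinement, §4.4 (4.41), (4.43)] -/
def twistBy (t : Plaquette d L → G) (w : Plaquette d L → G → ℝ) : Plaquette d L → G → ℝ :=
  fun p W => w p (t p * W)

/-- Unfolding `twistBy`. [cite: Tomboulis2007Confinement, §4 eq. (4.4)] -/
theorem twistBy_apply (t : Plaquette d L → G) (w : Plaquette d L → G → ℝ) (p : Plaquette d L) (W : G) :
    twistBy t w p W = w p (t p * W) := rfl

/-- The trivial insertion changes nothing. [cite: Tomboulis2007Confinement, §4 eq. (4.4)] -/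
theorem twistBy_one (w : Plaquette d L → G → ℝ) : twistBy (fun _ => (1 : G)) w = w := by
  funext p W
  rw [twistBy_apply, one_mul]

/-- Two successive insertions compose (the inner one acts first on the group element).
[cite: Tomboulis2007Confinement, §4 eq. (4.4)] -/
theorem twistBy_twistBy (t t' : Plaquette d L → G) (w : Plaquette d L → G → ℝ) :
    twistBy t (twistBy t' w) = twistBy (fun p => t' p * t p) w := by
  funext p W
  simp only [twistBy_apply, mul_assoc]

/-- **The family of ONE weight `w` with the twist element `z` inserted on the plaquette set `V`** — the datum
`(z, w, V)` of `CentralTwistPolymers.lean` as a plaquette-dependent family. [cite: Tomboulis2007Confinement, §4 eqs. (4.4)–(4.5)] -/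
def sheetFamily (z : G) (w : G → ℝ) (V : Finset (Plaquette d L)) : Plaquette d L → G → ℝ :=
  fun p W => if p ∈ V then w (z * W) else w W

/-- A sheet family is the constant family twisted by the insertion `z · 𝟙_V`.
[cite: Tomboulis2007Confinement, §4 eqs. (4.4)–(4.5)] -/
theorem sheetFamily_eq_twistBy (z : G) (w : G → ℝ) (V : Finset (Plaquette d L)) :
    sheetFamily z w V = twistBy (fun p => if p ∈ V then z else 1) (fun _ => w) := by
  funext p W
  by_cases hp : p ∈ V
  · simp only [sheetFamily, twistBy_apply, if_pos hp]
  · simp only [sheetFamily, twistBy_apply, if_neg hp, one_mul]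

/-- **The insertion of a 't Hooft twist** `z : Twist d G` (a centre element `z_q` for every plane `q`): `t_z(p) = z_p⁻¹`,
`z_p = z_q` on the corner plaquette `x_μ = x_ν = L-1` of each `q = (μ,ν)`-plane and `1` elsewhere — the factor of
`QuantumLattice.twistedHolonomy z U p = z_p⁻¹ U_p` ('t Hooft's `W{n; a_μ}`, all planes twisted at once).
[cite: tHooft1979Flux, §2 eqs. (2.5)–(2.6)] [cite: GarciaperezGonzalezarroyoOkawa2014, §6] -/
def twistInsertion (z : QuantumLattice.Twist d G) : Plaquette d L → G :=
  fun p => (QuantumLattice.plaquetteTwist z p)⁻¹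

/-- Unfolding `twistInsertion`. [cite: tHooft1979Flux, §2 eqs. (2.5)–(2.6)] -/
theorem twistInsertion_apply (z : QuantumLattice.Twist d G) (p : Plaquette d L) :
    twistInsertion z p = (QuantumLattice.plaquetteTwist z p)⁻¹ := rfl

/-- The trivial twist inserts nothing. [cite: tHooft1979Flux, §2 eqs. (2.5)–(2.6)] -/
theorem twistInsertion_one : twistInsertion (1 : QuantumLattice.Twist d G) = fun _ : Plaquette d L => (1 : G) := by
  funext p
  rw [twistInsertion_apply, QuantumLattice.plaquetteTwist_one, inv_one]

/-- Every value of the twist insertion is central. [cite: tHooft1979Flux, §2 eqs. (2.5)–(2.6)] -/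
theorem twistInsertion_mem_center (z : QuantumLattice.Twist d G) (p : Plaquette d L) :
    twistInsertion z p ∈ Subgroup.center G :=
  Subgroup.inv_mem _ (QuantumLattice.plaquetteTwist_mem_center z p)

/-- The twisted holonomy of `TwistedBoundaryConditions.lean` is the insertion times the holonomy.
[cite: GarciaperezGonzalezarroyoOkawa2014, §6] -/
theorem twistedHolonomy_eq_twistInsertion_mul (z : QuantumLattice.Twist d G) (U : GaugeConfig d L G) (p : Plaquette d L) :
    QuantumLattice.twistedHolonomy z U p = twistInsertion z p * plaquetteHolonomy U p.1 p.2.1.1 p.2.1.2 := rfl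

/-- **Wilson's weight as a (constant) family**: `w_p(W) = e^{β Re tr ρ(W)}` on every plaquette; twisted by an insertion `t`
it is the Gibbs factor `e^{βN#plaquettes} e^{-β S_t(U)}` of `insertedWilsonAction ρ t` (the bridge is proved in
`PlaquetteFieldTwistBound.lean`). [cite: Greensite2011Confinement, §4.4 (4.41)] [cite: tHooft1979Flux, §2 eq. (2.6)] -/
def wilsonFamily {N : ℕ} (ρ : G →* Matrix (Fin N) (Fin N) ℂ) (β : ℝ) : Plaquette d L → G → ℝ :=
  fun _ W => Real.exp (β * ((ρ W).trace).re)

/-- Unfolding `wilsonFamily`. [cite: Greensite2011Confinement, §4.4 (4.41)] -/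
theorem wilsonFamily_apply {N : ℕ} (ρ : G →* Matrix (Fin N) (Fin N) ℂ) (β : ℝ) (p : Plaquette d L) (W : G) :
    wilsonFamily ρ β p W = Real.exp (β * ((ρ W).trace).re) := rfl

/-! ### Activities of a family -/

/-- **The plaquette activity of a family**: `w_p(U_p) - 1` (arXiv:0707.2179 (6.7) `g_p(U) = f_p(U) - 1`, the weight allowed
to depend on the plaquette). [cite: Tomboulis2007Confinement, §6.2 eq. (6.7)] -/
def fieldActivity (w : Plaquette d L → G → ℝ) (U : GaugeConfig d L G) (p : Plaquette d L) : ℝ :=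
  w p (plaquetteHolonomy U p.1 p.2.1.1 p.2.1.2) - 1

/-- `1 +` activity is the weight. [cite: Tomboulis2007Confinement, §6.2 eq. (6.7)] -/
theorem one_add_fieldActivity (w : Plaquette d L → G → ℝ) (U : GaugeConfig d L G) (p : Plaquette d L) :
    1 + fieldActivity w U p = w p (plaquetteHolonomy U p.1 p.2.1.1 p.2.1.2) := by
  unfold fieldActivity; ring

/-- The activity of a twisted family reads `w_p(t_p U_p) - 1`. [cite: Tomboulis2007Confinement, §6.2 eq. (6.7) and §4 eq. (4.4)] -/
theorem fieldActivity_twistBy (t : Plaquette d L → G) (w : Plaquette d L → G → ℝ) (U : GaugeConfig d L G)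
    (p : Plaquette d L) :
    fieldActivity (twistBy t w) U p = w p (t p * plaquetteHolonomy U p.1 p.2.1.1 p.2.1.2) - 1 := rfl

/-- For a sheet family the activity IS `twistActivity` of `CentralTwistPolymers.lean` (definitional).
[cite: Tomboulis2007Confinement, §6.2 eq. (6.7) and §4 eq. (4.4)] -/
theorem fieldActivity_sheetFamily (z : G) (w : G → ℝ) (V : Finset (Plaquette d L)) (U : GaugeConfig d L G)
    (p : Plaquette d L) : fieldActivity (sheetFamily z w V) U p = twistActivity z w V U p := rfl

section Measure

variable [TopologicalSpace G] [IsTopologicalGroup G] [CompactSpace G] [MeasurableSpace G] [BorelSpace G]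
variable [NeZero L]

/-- **The polymer activity of a family**: `z_w(X) = ∫ ∏_{p∈X} (w_p(U_p) - 1) ∏_b dU_b` (complex; `0` unless `X` is a
polymer) (arXiv:0707.2179 eq. (6.6)). [cite: Tomboulis2007Confinement, §6.2 eq. (6.6)] -/
def fieldPolymerActivity (w : Plaquette d L → G → ℝ) (X : Finset (Plaquette d L)) : ℂ :=
  by classical exact
  if IsRConnected linkRel X then
    (((∫ U, ∏ p ∈ X, fieldActivity w U p ∂(Measure.pi fun _ : Edge d L => haarProbability G)) : ℝ) : ℂ)
  else 0

/-- The activity of a polymer is the Haar integral of the product of its plaquette activities.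
[cite: Tomboulis2007Confinement, §6.2 eq. (6.6)] -/
theorem fieldPolymerActivity_of_isRConnected {w : Plaquette d L → G → ℝ} {X : Finset (Plaquette d L)}
    (hX : IsRConnected linkRel X) :
    fieldPolymerActivity w X =
      (((∫ U, ∏ p ∈ X, fieldActivity w U p ∂(Measure.pi fun _ : Edge d L => haarProbability G)) : ℝ) : ℂ) := by
  classical
  simp [fieldPolymerActivity, hX]

/-- Non-polymers carry no activity. [cite: Tomboulis2007Confinement, §6.2 eq. (6.6)] -/
theorem fieldPolymerActivity_of_not_isRConnected {w : Plaquette d L → G → ℝ} {X : Finset (Plaquette d L)}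
    (hX : ¬ IsRConnected linkRel X) : fieldPolymerActivity w X = 0 := by
  classical
  simp [fieldPolymerActivity, hX]

/-- For a sheet family the polymer activity IS `twistPolymerActivity`. [cite: Tomboulis2007Confinement, §6.2 eq. (6.6)] -/
theorem fieldPolymerActivity_sheetFamily (z : G) (w : G → ℝ) (V X : Finset (Plaquette d L)) :
    fieldPolymerActivity (sheetFamily z w V) X = twistPolymerActivity z w V X := by
  by_cases hX : IsRConnected linkRel X
  · rw [fieldPolymerActivity_of_isRConnected hX, twistPolymerActivity_of_isRConnected z hX]
    rfl
  · rw [fieldPolymerActivity_of_not_isRConnected hX, twistPolymerActivity_of_not_isRConnected z hX]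

variable (d L) in
/-- **The partition function of a family**: `Z_w = ∫ ∏_p w_p(U_p) ∏_b dU_b` (arXiv:0707.2179 (4.5)/(6.5) with a
plaquette-dependent weight; for `w_p = e^{β Re tr ρ(t_p ·)}` it is `e^{βN#plaquettes} · insertedPartitionFunction ρ β L t`).
[cite: Tomboulis2007Confinement, §4 eq. (4.5)] [cite: Greensite2011Confinement, §4.4 (4.41), (4.44)] -/
def fieldZ (w : Plaquette d L → G → ℝ) : ℝ :=
  ∫ U, ∏ p : Plaquette d L, w p (plaquetteHolonomy U p.1 p.2.1.1 p.2.1.2)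
    ∂(Measure.pi fun _ : Edge d L => haarProbability G)

/-- For a sheet family the partition function IS `twistZ d L z w V` (hence `weightZ`, `torusZtw`, … downstream).
[cite: Tomboulis2007Confinement, §4 eq. (4.5)] -/
theorem fieldZ_sheetFamily (z : G) (w : G → ℝ) (V : Finset (Plaquette d L)) :
    fieldZ d L (sheetFamily z w V) = twistZ d L z w V := rfl

/-- The partition function of a twisted family, unfolded. [cite: Tomboulis2007Confinement, §4 eqs. (4.4)–(4.5)] -/
theorem fieldZ_twistBy (t : Plaquette d L → G) (w : Plaquette d L → G → ℝ) :
    fieldZ d L (twistBy t w) =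
      ∫ U, ∏ p : Plaquette d L, w p (t p * plaquetteHolonomy U p.1 p.2.1.1 p.2.1.2)
        ∂(Measure.pi fun _ : Edge d L => haarProbability G) := rfl

/-- Non-vacuity: the trivial family has partition function `1` (the product Haar measure is a probability measure).
[cite: Tomboulis2007Confinement, §4 eq. (4.5)] -/
theorem fieldZ_one : fieldZ d L (fun (_ : Plaquette d L) (_ : G) => (1 : ℝ)) = 1 := by
  simp [fieldZ]

/-- Scaling every weight by the same constant scales `fieldZ` by its `#plaquettes`-th power (ratios of partition
functions of families differing by an insertion are scale-invariant). [cite: Tomboulis2007Confinement, §6.1 eq. (6.1)] -/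
theorem fieldZ_const_mul (κ : ℝ) (w : Plaquette d L → G → ℝ) :
    fieldZ d L (fun p W => κ * w p W) = κ ^ Fintype.card (Plaquette d L) * fieldZ d L w := by
  unfold fieldZ
  rw [← integral_const_mul]
  congr 1
  funext U
  rw [← Finset.card_univ, ← Finset.prod_const, ← Finset.prod_mul_distrib]

end Measure

end CentralTwist

end Literature.MathematicalPhysics.QuantumFieldTheory

end
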